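import Mathlib
import Literature.NumberTheory.Irrationality.RhinViola2001.Theorem21Bookkeeping
import Literature.NumberTheory.Transcendental.BeukersZetaThreeIntegralsLegendreProofs
import Literature.NumberTheory.Transcendental.BeukersZetaThreeIntegralsDiagProofs
import HarnessLib

/-!
# Rhin–Viola 2001, Theorem 2.1 — II: the analytic steps of the printed proof

Topic `Literature/NumberTheory/Irrationality/RhinViola2001`. Second of three files (cell `zeta5-irr`, seat zi-lit g11)
discharging the named fact `theorem21` of `GroupStructure.lean` [RhinViola2001, Theorem 2.1] by the printed proof
(Acta Arith. 97 (2001), pp. 274–275, held text `paper:doi-10-4064-aa97-3-6` read on the page). This file proves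
the four analytic ingredients, for the triple integrals `I(h,j,k,l,m,q,r,s)` (2.1) = `RhinViola2001.I` (Lebesgue
integrals over the open unit cube):

* integrability on the cube for non-negative parameters with (2.2)–(2.3) — "this integral is finite if … `h, j, k,
  l, q, r, s ≥ 0` and `h ≤ k + r`" (p. 271; with (2.2), `h ≤ k + r` is `m ≥ 0`): the integrand is dominated by
  `1/(1−(1−xy)z)`, whose integrability on the cube is the tree's `Beukers.integrableOn_cube_of_le`
  (`integrand_le_one_div`, `integrableOn_integrand`);
* **(2.10)** as an identity of integrals (`I_decomp`): "we use the linear decomposition of `I` given by the identity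
  `(1−x)(1−z) = 1−x−(1−x)z`";
* the **polynomial case** (`exists_int_of_lt`): "If `q+h−r < 0`, then `I` is the integral of a polynomial in
  `x, y, z` with integer coefficients and partial degrees `r+l−q−1`, `m+s−q−1`, `j+r−h−1`. Therefore
  `d_{r+l−q} d_{m+s−q} d_{j+r−h} I ∈ ℤ`" — through an explicit `MvPolynomial (Fin 3) ℤ`, its partial degrees
  (`MvPolynomial.degreeOf`) and the monomial integrals `∫∫∫ x^a y^b z^c = 1/((a+1)(b+1)(c+1))` (the route of the
  tree's `RhinViola.exists_poly_eq_lcm_mul_setIntegral_aeval` for the 2005 dilogarithm paper);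
* the **base case (2.11)** (`I_baseP`, `good_baseP`):
  `I(h,0,h,0,h,0,h,0) = ∫∫∫ x^h y^h dx dy dz/(1−(1−xy)z) = ∫∫ −log(xy)/(1−xy) x^h y^h dx dy = −2Σ_{ν=1}^h ν⁻³ + 2ζ(3)`
  "by Lemma 1 of [Beukers]" — the tree's `Beukers.logKernelIntegral_diag_holds` after the `z`-integration
  `∫₀¹ dz/(1−az) = −log(1−a)/a` (`Beukers.integral_one_div_one_sub_mul`) and Fubini over the last coordinate
  (`Beukers.integral_cube_eq_integral_square_integral`).

Everything is PROVED; no definition, no named fact. HONEST FRAMING (cells pub-zeta5 / zeta5-irr): Rhin–Viola's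
`ζ(3)` arithmetic AS PRINTED in 2001; nothing here concerns `ζ(5)`; records in print unmoved.
-/

noncomputable section

namespace Literature.NumberTheory.Irrationality.RhinViola2001

namespace Theorem21

open MeasureTheory Set Finset
open Literature.NumberTheory.Transcendental (zetaValue)
open Literature.NumberTheory.Transcendental.Beukers (measurableSet_cube volume_restrict_cube
  integral_cube_eq_integral_square_integral insertNth_two_eq mul_le_den one_sub_le_den den_pos
  integrableOn_cube_of_le integral_one_div_one_sub_mul integral_pow_Ioo_zero_one integrableOn_pow_Ioo_zero_one
  measurableSet_unitSq logKernelIntegral logKernelIntegral_diag_holds)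

/-! ### The integrand on the open cube: positivity, domination by `1/(1−(1−xy)z)`, continuity -/

/-- A power with a non-negative integer exponent is the corresponding natural power. [folklore] -/
private theorem zpow_eq_pow_toNat (x : ℝ) {n : ℤ} (hn : 0 ≤ n) : x ^ n = x ^ n.toNat := by
  obtain ⟨k, rfl⟩ := Int.eq_ofNat_of_zero_le hn
  simp

/-- The key pointwise inequality behind the finiteness condition of (2.1): for `0 < x, y, z < 1` and natural
exponents with `h ≤ k + r`,
`x^h (1−x)^l y^k (1−y)^s z^j (1−z)^q / (1−(1−xy)z)^{q+h−r+1} ≤ 1/(1−(1−xy)z)`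
(pairing `(1−z)^q` with `(1−(1−xy)z)^q ≥ (1−z)^q` and `x^h y^k` with `(1−(1−xy)z)^{h−r} ≥ (xy)^{h−r}`).
[cite: RhinViola2001, §2 p. 271 (finiteness of (2.1) iff `h, j, k, l, q, r, s ≥ 0` and `h ≤ k + r`)] -/
theorem key_bound {x y z : ℝ} (hx : x ∈ Ioo (0 : ℝ) 1) (hy : y ∈ Ioo (0 : ℝ) 1) (hz : z ∈ Ioo (0 : ℝ) 1)
    (h l k s j q r : ℕ) (hm : h ≤ k + r) :
    x ^ h * (1 - x) ^ l * y ^ k * (1 - y) ^ s * z ^ j * (1 - z) ^ q /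
        (1 - (1 - x * y) * z) ^ ((q : ℤ) + h - r + 1) ≤ 1 / (1 - (1 - x * y) * z) := by
  set D := 1 - (1 - x * y) * z with hD
  have hDpos : 0 < D := den_pos hx hy hz
  have hDle : D ≤ 1 := by
    have : 0 ≤ (1 - x * y) * z := mul_nonneg (by nlinarith [hx.2, hy.2, hx.1, hy.1]) hz.1.le
    linarith
  have hxy_le : x * y ≤ D := mul_le_den hx hy hz
  have h1z_le : 1 - z ≤ D := one_sub_le_den hx hy hz
  have hx0 := hx.1.le; have hx1 := hx.2.le; have hy0 := hy.1.le; have hy1 := hy.2.le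
  have hz0 := hz.1.le; have hz1 := hz.2.le
  have h1x0 : 0 ≤ 1 - x := by linarith
  have h1y0 : 0 ≤ 1 - y := by linarith
  have h1z0 : 0 ≤ 1 - z := by linarith
  -- the numerator is at most `x^h y^k (1-z)^q`, itself at most `1`
  set Num := x ^ h * (1 - x) ^ l * y ^ k * (1 - y) ^ s * z ^ j * (1 - z) ^ q with hNum
  have hNum0 : 0 ≤ Num := by positivity
  have hNum_le : Num ≤ x ^ h * y ^ k * (1 - z) ^ q := by
    have e1 : (1 - x) ^ l ≤ 1 := pow_le_one₀ h1x0 (by linarith)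
    have e2 : (1 - y) ^ s ≤ 1 := pow_le_one₀ h1y0 (by linarith)
    have e3 : z ^ j ≤ 1 := pow_le_one₀ hz0 hz1
    calc Num = (x ^ h * y ^ k * (1 - z) ^ q) * ((1 - x) ^ l * (1 - y) ^ s * z ^ j) := by rw [hNum]; ring
      _ ≤ (x ^ h * y ^ k * (1 - z) ^ q) * 1 := by
          apply mul_le_mul_of_nonneg_left _ (by positivity)
          calc (1 - x) ^ l * (1 - y) ^ s * z ^ j ≤ 1 * 1 * 1 :=
                mul_le_mul (mul_le_mul e1 e2 (by positivity) zero_le_one) e3 (by positivity) (by positivity)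
            _ = 1 := by ring
      _ = _ := mul_one _
  have hxyk_le_one : x ^ h * y ^ k * (1 - z) ^ q ≤ 1 := by
    calc x ^ h * y ^ k * (1 - z) ^ q ≤ 1 * 1 * 1 :=
          mul_le_mul (mul_le_mul (pow_le_one₀ hx0 hx1) (pow_le_one₀ hy0 hy1) (by positivity) zero_le_one)
            (pow_le_one₀ h1z0 (by linarith)) (by positivity) (by positivity)
      _ = 1 := by ring
  -- reduce to `Num * D ≤ D ^ u`
  rw [div_le_div_iff₀ (zpow_pos hDpos _) hDpos, one_mul]
  by_cases hu : (q : ℤ) + h - r + 1 ≤ 0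
  · -- `D^u ≥ 1 ≥ Num * D`
    calc Num * D ≤ 1 * 1 := mul_le_mul (hNum_le.trans hxyk_le_one) hDle hDpos.le zero_le_one
      _ = 1 := one_mul _
      _ ≤ D ^ ((q : ℤ) + h - r + 1) := one_le_zpow_of_nonpos₀ hDpos hDle hu
  · -- `u = n + 1`, `n = q + h - r ≥ 0`; show `Num ≤ D ^ n`
    push Not at hu
    obtain ⟨n, hn⟩ : ∃ n : ℕ, (q : ℤ) + h - r = n := ⟨((q : ℤ) + h - r).toNat, by omega⟩
    have hu' : (q : ℤ) + h - r + 1 = ((n + 1 : ℕ) : ℤ) := by push_cast; omega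
    rw [hu', zpow_natCast, pow_succ]
    apply mul_le_mul_of_nonneg_right _ hDpos.le
    refine hNum_le.trans ?_
    by_cases hnq : n ≤ q
    · -- `D^n ≥ (1-z)^n ≥ (1-z)^q ≥ x^h y^k (1-z)^q`
      calc x ^ h * y ^ k * (1 - z) ^ q ≤ 1 * 1 * (1 - z) ^ n :=
            mul_le_mul (mul_le_mul (pow_le_one₀ hx0 hx1) (pow_le_one₀ hy0 hy1) (by positivity) zero_le_one)
              (pow_le_pow_of_le_one h1z0 (by linarith) hnq) (by positivity) (by positivity)
        _ = (1 - z) ^ n := by ring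
        _ ≤ D ^ n := pow_le_pow_left₀ h1z0 h1z_le n
    · -- `n = q + e`, `e = h - r`, `e ≤ h`, `e ≤ k`; `D^n = D^q D^e ≥ (1-z)^q (xy)^e ≥ (1-z)^q x^h y^k`
      push Not at hnq
      obtain ⟨e, rfl⟩ : ∃ e : ℕ, n = q + e := ⟨n - q, by omega⟩
      have heh : e ≤ h := by omega
      have hek : e ≤ k := by omega
      calc x ^ h * y ^ k * (1 - z) ^ q ≤ x ^ e * y ^ e * (1 - z) ^ q :=
            mul_le_mul_of_nonneg_right
              (mul_le_mul (pow_le_pow_of_le_one hx0 hx1 heh) (pow_le_pow_of_le_one hy0 hy1 hek)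
                (by positivity) (by positivity)) (by positivity)
        _ = (1 - z) ^ q * (x * y) ^ e := by rw [mul_pow]; ring
        _ ≤ D ^ q * D ^ e :=
            mul_le_mul (pow_le_pow_left₀ h1z0 h1z_le q) (pow_le_pow_left₀ (by positivity) hxy_le e)
              (by positivity) (by positivity)
        _ = D ^ (q + e) := (pow_add _ _ _).symm

/-- The integrand of (2.1) written with natural exponents, for non-negative parameters. [cite: RhinViola2001, §2 (2.1)] -/
theorem integrand_eq_pow {P : Params} (hP : P.Nonneg) (p : Fin 3 → ℝ) :
    integrand P p = p 0 ^ P.h.toNat * (1 - p 0) ^ P.l.toNat * p 1 ^ P.k.toNat * (1 - p 1) ^ P.s.toNat *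
        p 2 ^ P.j.toNat * (1 - p 2) ^ P.q.toNat / (1 - (1 - p 0 * p 1) * p 2) ^ (P.q + P.h - P.r + 1) := by
  obtain ⟨h0, h1, h2, h3, _, h5, _, h7⟩ := hP
  rw [integrand, zpow_eq_pow_toNat (p 0) h0, zpow_eq_pow_toNat (1 - p 0) h3, zpow_eq_pow_toNat (p 1) h2,
    zpow_eq_pow_toNat (1 - p 1) h7, zpow_eq_pow_toNat (p 2) h1, zpow_eq_pow_toNat (1 - p 2) h5]

/-- On the open cube the integrand of (2.1) is non-negative (non-negative parameters). [cite: RhinViola2001, §2 (2.1)] -/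
theorem integrand_nonneg {P : Params} (hP : P.Nonneg) {p : Fin 3 → ℝ} (hp : p ∈ cube) : 0 ≤ integrand P p := by
  rw [integrand_eq_pow hP]
  have hx := hp 0; have hy := hp 1; have hz := hp 2
  have := den_pos hx hy hz
  have : 0 ≤ 1 - p 0 := by linarith [hx.2]
  have : 0 ≤ 1 - p 1 := by linarith [hy.2]
  have : 0 ≤ 1 - p 2 := by linarith [hz.2]
  have := hx.1; have := hy.1; have := hz.1
  apply div_nonneg (by positivity) (zpow_nonneg (by linarith) _)

/-- "this integral is finite if and only if `h, j, k, l, q, r, s ≥ 0` and `h ≤ k + r`" — the domination that proves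
the "if": for non-negative parameters with (2.2) (so `h ≤ k + r` reads `m ≥ 0`) the integrand of (2.1) is at most
`1/(1−(1−xy)z)` on the open cube. [cite: RhinViola2001, §2 p. 271] -/
theorem integrand_le_one_div {P : Params} (hP : P.Nonneg) (hB : P.Balanced) {p : Fin 3 → ℝ} (hp : p ∈ cube) :
    integrand P p ≤ 1 / (1 - (1 - p 0 * p 1) * p 2) := by
  have hN := hP
  obtain ⟨h0, h1, h2, h3, h4, h5, h6, h7⟩ := hP
  rw [integrand_eq_pow hN]
  have hexp : P.q + P.h - P.r + 1 = (P.q.toNat : ℤ) + (P.h.toNat : ℕ) - (P.r.toNat : ℕ) + 1 := by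
    rw [Int.toNat_of_nonneg h5, Int.toNat_of_nonneg h0, Int.toNat_of_nonneg h6]
  rw [hexp]
  refine key_bound (hp 0) (hp 1) (hp 2) _ _ _ _ _ _ _ ?_
  have := hB.1
  omega

/-- The integrand of (2.1) is continuous on the open cube (all bases of the powers are positive there).
[cite: RhinViola2001, §2 (2.1)] -/
theorem continuousOn_integrand (P : Params) : ContinuousOn (integrand P) cube := by
  have c0 : Continuous fun p : Fin 3 → ℝ => p 0 := continuous_apply 0
  have c1 : Continuous fun p : Fin 3 → ℝ => p 1 := continuous_apply 1
  have c2 : Continuous fun p : Fin 3 → ℝ => p 2 := continuous_apply 2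
  have hne0 : ∀ p ∈ cube, (fun p : Fin 3 → ℝ => p 0) p ≠ 0 ∨ 0 ≤ P.h := fun p hp => Or.inl (hp 0).1.ne'
  have hne1 : ∀ p ∈ cube, (fun p : Fin 3 → ℝ => 1 - p 0) p ≠ 0 ∨ 0 ≤ P.l :=
    fun p hp => Or.inl (by have := (hp 0).2; simp only; linarith)
  have hne2 : ∀ p ∈ cube, (fun p : Fin 3 → ℝ => p 1) p ≠ 0 ∨ 0 ≤ P.k := fun p hp => Or.inl (hp 1).1.ne'
  have hne3 : ∀ p ∈ cube, (fun p : Fin 3 → ℝ => 1 - p 1) p ≠ 0 ∨ 0 ≤ P.s :=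
    fun p hp => Or.inl (by have := (hp 1).2; simp only; linarith)
  have hne4 : ∀ p ∈ cube, (fun p : Fin 3 → ℝ => p 2) p ≠ 0 ∨ 0 ≤ P.j := fun p hp => Or.inl (hp 2).1.ne'
  have hne5 : ∀ p ∈ cube, (fun p : Fin 3 → ℝ => 1 - p 2) p ≠ 0 ∨ 0 ≤ P.q :=
    fun p hp => Or.inl (by have := (hp 2).2; simp only; linarith)
  have hne6 : ∀ p ∈ cube, (fun p : Fin 3 → ℝ => 1 - (1 - p 0 * p 1) * p 2) p ≠ 0 ∨ 0 ≤ P.q + P.h - P.r + 1 :=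
    fun p hp => Or.inl (den_pos (hp 0) (hp 1) (hp 2)).ne'
  have f0 := (c0.continuousOn (s := cube)).zpow₀ P.h hne0
  have f1 := ((continuous_const.sub c0).continuousOn (s := cube)).zpow₀ P.l hne1
  have f2 := (c1.continuousOn (s := cube)).zpow₀ P.k hne2
  have f3 := ((continuous_const.sub c1).continuousOn (s := cube)).zpow₀ P.s hne3
  have f4 := (c2.continuousOn (s := cube)).zpow₀ P.j hne4
  have f5 := ((continuous_const.sub c2).continuousOn (s := cube)).zpow₀ P.q hne5
  have f6 := ((continuous_const.sub ((continuous_const.sub (c0.mul c1)).mul c2)).continuousOn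
    (s := cube)).zpow₀ (P.q + P.h - P.r + 1) hne6
  have hden : ∀ p ∈ cube, (1 - (1 - p 0 * p 1) * p 2) ^ (P.q + P.h - P.r + 1) ≠ 0 :=
    fun p hp => (zpow_pos (den_pos (hp 0) (hp 1) (hp 2)) _).ne'
  exact (((((f0.mul f1).mul f2).mul f3).mul f4).mul f5).div f6 hden

/-- **Finiteness of (2.1)** for non-negative parameters satisfying (2.2): the integrand is integrable on the open
cube (dominated by `1/(1−(1−xy)z)`). [cite: RhinViola2001, §2 p. 271] -/
theorem integrableOn_integrand {P : Params} (hP : P.Nonneg) (hB : P.Balanced) :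
    IntegrableOn (integrand P) cube := by
  refine integrableOn_cube_of_le (C := 1) zero_le_one (continuousOn_integrand P) fun p hp => ?_
  rw [abs_of_nonneg (integrand_nonneg hP hp)]
  exact integrand_le_one_div hP hB hp

/-! ### (2.10): the linear decomposition -/

/-- The identity `(1−x)(1−z) = 1−x−(1−x)z` at the level of the integrands of (2.10), on the open cube.
[cite: RhinViola2001, §2 (2.10)] -/
theorem integrand_decomp (P : Params) {p : Fin 3 → ℝ} (hp : p ∈ cube) :
    integrand P p = integrand (childA P) p - integrand (childB P) p - integrand (childC P) p := by
  have hx0 : p 0 ≠ 0 := (hp 0).1.ne'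
  have hx1 : 1 - p 0 ≠ 0 := by have := (hp 0).2; linarith
  have hz0 : p 2 ≠ 0 := (hp 2).1.ne'
  have hz1 : 1 - p 2 ≠ 0 := by have := (hp 2).2; linarith
  have hD : (1 - (1 - p 0 * p 1) * p 2) ≠ 0 := (den_pos (hp 0) (hp 1) (hp 2)).ne'
  simp only [integrand, childA, childB, childC]
  have eA : P.q - 1 + P.h - (P.r - 1) + 1 = P.q + P.h - P.r + 1 := by ring
  have eB : P.q - 1 + (P.h + 1) - P.r + 1 = P.q + P.h - P.r + 1 := by ring
  rw [eA, eB, zpow_sub_one₀ hx1, zpow_sub_one₀ hz1, zpow_add_one₀ hx0, zpow_add_one₀ hz0]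
  field_simp

/-- **The linear decomposition (2.10)**: for non-negative parameters with (2.2)–(2.3) and `l, m, q, r ≥ 1`,
`I(h,j,k,l,m,q,r,s) = I(h,j,k,l−1,m−1,q−1,r−1,s) − I(h+1,j,k,l−1,m−1,q−1,r,s) − I(h,j+1,k,l,m−1,q−1,r−1,s)`
("and each of the three integrals thus obtained satisfies (2.2) and (2.3)").
[cite: RhinViola2001, §2 (2.10), p. 274] -/
theorem I_decomp {P : Params} (hP : P.Nonneg) (hB : P.Balanced) (hl : 1 ≤ P.l) (hm : 1 ≤ P.m) (hq : 1 ≤ P.q)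
    (hr : 1 ≤ P.r) : I P = I (childA P) - I (childB P) - I (childC P) := by
  have iA := integrableOn_integrand (nonneg_childA hP hl hm hq hr) (balanced_childA hB)
  have iB := integrableOn_integrand (nonneg_childB hP hl hm hq) (balanced_childB hB)
  have iC := integrableOn_integrand (nonneg_childC hP hm hq hr) (balanced_childC hB)
  have iAB : IntegrableOn (fun p => integrand (childA P) p - integrand (childB P) p) cube := iA.sub iB
  unfold I
  rw [← integral_sub iA iB, ← integral_sub iAB iC]
  refine setIntegral_congr_fun (measurableSet_cube 3) fun p hp => ?_
  exact integrand_decomp P hp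

/-! ### The polynomial case `q + h − r < 0` -/

/-- `i ∣ lcm(1,…,n)` for `1 ≤ i ≤ n`. [folklore] -/
private theorem dvd_lcmUpto_of_le {i n : ℕ} (hi : 1 ≤ i) (hin : i ≤ n) : i ∣ Nat.lcmUpto n :=
  Finset.dvd_lcm (f := id) (by rw [Finset.mem_Icc]; omega)

/-- `∫∫∫_{(0,1)³} x^a y^b z^c dx dy dz = 1/((a+1)(b+1)(c+1))`, and the monomial is integrable on the cube.
[cite: RhinViola2001, §2 p. 274 (proof of Theorem 2.1: "`I` is the integral of a polynomial … Therefore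
`d_{r+l−q} d_{m+s−q} d_{j+r−h} I ∈ ℤ`")] -/
theorem integrableOn_monomial_and_integral_eq (a b c : ℕ) :
    IntegrableOn (fun p : Fin 3 → ℝ => p 0 ^ a * p 1 ^ b * p 2 ^ c) cube ∧
      ∫ p in cube, p 0 ^ a * p 1 ^ b * p 2 ^ c = 1 / (((a : ℝ) + 1) * ((b : ℝ) + 1) * ((c : ℝ) + 1)) := by
  let G : Fin 3 → ℝ → ℝ := ![fun x => x ^ a, fun x => x ^ b, fun x => x ^ c]
  have hGi : ∀ i, Integrable (G i) ((volume : Measure ℝ).restrict (Ioo 0 1)) := by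
    intro i
    fin_cases i
    · exact integrableOn_pow_Ioo_zero_one a
    · exact integrableOn_pow_Ioo_zero_one b
    · exact integrableOn_pow_Ioo_zero_one c
  have hprod : (fun p : Fin 3 → ℝ => p 0 ^ a * p 1 ^ b * p 2 ^ c) = fun p => ∏ i, G i (p i) := by
    funext p
    simp [G, Fin.prod_univ_three]
  constructor
  · rw [IntegrableOn, cube, volume_restrict_cube 3, hprod]
    exact Integrable.fintype_prod (f := G) hGi
  · rw [cube, volume_restrict_cube 3, hprod, integral_fintype_prod_eq_prod G]
    simp [G, Fin.prod_univ_three, integral_pow_Ioo_zero_one]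
    ring

/-- Evaluation of an integer trivariate polynomial as the finite sum of its monomials. [folklore] -/
private theorem aeval_eq_sum_coeff (f : MvPolynomial (Fin 3) ℤ) (v : Fin 3 → ℝ) :
    MvPolynomial.aeval v f =
      ∑ d ∈ f.support, ((MvPolynomial.coeff d f : ℤ) : ℝ) * (v 0 ^ d 0 * v 1 ^ d 1 * v 2 ^ d 2) := by
  rw [MvPolynomial.aeval_def, MvPolynomial.eval₂_eq']
  refine sum_congr rfl fun d _ => ?_
  rw [Fin.prod_univ_three]
  simp

/-- **`d_A d_B d_C ∫∫∫_{(0,1)³} f ∈ ℤ`** for an integer polynomial `f(x,y,z)` with `deg_x f < A`, `deg_y f < B`,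
`deg_z f < C` (monomialwise: `∫∫∫ x^a y^b z^c = 1/((a+1)(b+1)(c+1))` and `(a+1) ∣ d_A`, …).
[cite: RhinViola2001, §2 p. 274 (proof of Theorem 2.1, the case `q + h − r < 0`)] -/
theorem exists_int_lcm_mul_integral_aeval (f : MvPolynomial (Fin 3) ℤ) {A B C : ℕ}
    (hA : f.degreeOf 0 < A) (hB : f.degreeOf 1 < B) (hC : f.degreeOf 2 < C) :
    ∃ T : ℤ, ((Nat.lcmUpto A : ℝ) * Nat.lcmUpto B * Nat.lcmUpto C) *
      ∫ p in cube, MvPolynomial.aeval p f = T := by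
  refine ⟨∑ d ∈ f.support, MvPolynomial.coeff d f * ((Nat.lcmUpto A : ℤ) / (d 0 + 1)) *
    ((Nat.lcmUpto B : ℤ) / (d 1 + 1)) * ((Nat.lcmUpto C : ℤ) / (d 2 + 1)), ?_⟩
  have hint : ∫ p in cube, MvPolynomial.aeval p f =
      ∑ d ∈ f.support, ((MvPolynomial.coeff d f : ℤ) : ℝ) /
        ((((d 0 : ℕ) : ℝ) + 1) * (((d 1 : ℕ) : ℝ) + 1) * (((d 2 : ℕ) : ℝ) + 1)) := by
    simp only [aeval_eq_sum_coeff]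
    rw [integral_finsetSum _ fun d _ => ?_]
    · refine sum_congr rfl fun d _ => ?_
      rw [integral_const_mul, (integrableOn_monomial_and_integral_eq (d 0) (d 1) (d 2)).2]
      ring
    · exact (integrableOn_monomial_and_integral_eq (d 0) (d 1) (d 2)).1.const_mul _
  rw [hint, mul_sum]
  push_cast
  refine sum_congr rfl fun d hd => ?_
  have h0 : d 0 + 1 ≤ A := by
    have := MvPolynomial.monomial_le_degreeOf 0 hd
    omega
  have h1 : d 1 + 1 ≤ B := by
    have := MvPolynomial.monomial_le_degreeOf 1 hd
    omega
  have h2 : d 2 + 1 ≤ C := by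
    have := MvPolynomial.monomial_le_degreeOf 2 hd
    omega
  have hdA : ((d 0 + 1 : ℕ) : ℤ) ∣ (Nat.lcmUpto A : ℤ) := by exact_mod_cast dvd_lcmUpto_of_le (by omega) h0
  have hdB : ((d 1 + 1 : ℕ) : ℤ) ∣ (Nat.lcmUpto B : ℤ) := by exact_mod_cast dvd_lcmUpto_of_le (by omega) h1
  have hdC : ((d 2 + 1 : ℕ) : ℤ) ∣ (Nat.lcmUpto C : ℤ) := by exact_mod_cast dvd_lcmUpto_of_le (by omega) h2
  have ha0 : ((d 0 : ℝ) + 1) ≠ 0 := by positivity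
  have hb0 : ((d 1 : ℝ) + 1) ≠ 0 := by positivity
  have hc0 : ((d 2 : ℝ) + 1) ≠ 0 := by positivity
  rw [Int.cast_div (by exact_mod_cast hdA) (by push_cast; exact ha0),
    Int.cast_div (by exact_mod_cast hdB) (by push_cast; exact hb0),
    Int.cast_div (by exact_mod_cast hdC) (by push_cast; exact hc0)]
  push_cast
  field_simp

/-- The polynomial `S = X₀^h (1−X₀)^l X₁^k (1−X₁)^s X₂^j (1−X₂)^q (1 − (1 − X₀X₁)X₂)^n ∈ ℤ[X₀,X₁,X₂]` of the case
`q + h − r < 0` (`n = r − q − h − 1`), its evaluation. [cite: RhinViola2001, §2 p. 274] -/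
theorem aeval_rvPoly (h l k s j q n : ℕ) (v : Fin 3 → ℝ) :
    MvPolynomial.aeval v (MvPolynomial.X 0 ^ h * (1 - MvPolynomial.X 0) ^ l * MvPolynomial.X 1 ^ k *
        (1 - MvPolynomial.X 1) ^ s * MvPolynomial.X 2 ^ j * (1 - MvPolynomial.X 2) ^ q *
        (1 - (1 - MvPolynomial.X 0 * MvPolynomial.X 1) * MvPolynomial.X 2) ^ n : MvPolynomial (Fin 3) ℤ) =
      v 0 ^ h * (1 - v 0) ^ l * v 1 ^ k * (1 - v 1) ^ s * v 2 ^ j * (1 - v 2) ^ q *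
        (1 - (1 - v 0 * v 1) * v 2) ^ n := by
  simp

/-- Its partial degrees: `deg_x S ≤ h + l + n`, `deg_y S ≤ k + s + n`, `deg_z S ≤ j + q + n` ("partial degrees
`r+l−q−1`, `m+s−q−1`, `j+r−h−1`"), in one statement for the three variables. [cite: RhinViola2001, §2 p. 274] -/
theorem degreeOf_rvPoly_le (h l k s j q n : ℕ) (i : Fin 3) :
    (MvPolynomial.X 0 ^ h * (1 - MvPolynomial.X 0) ^ l * MvPolynomial.X 1 ^ k *
        (1 - MvPolynomial.X 1) ^ s * MvPolynomial.X 2 ^ j * (1 - MvPolynomial.X 2) ^ q *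
        (1 - (1 - MvPolynomial.X 0 * MvPolynomial.X 1) * MvPolynomial.X 2) ^ n : MvPolynomial (Fin 3) ℤ).degreeOf i ≤
      h * (if i = 0 then 1 else 0) + l * (if i = 0 then 1 else 0) + k * (if i = 1 then 1 else 0) +
        s * (if i = 1 then 1 else 0) + j * (if i = 2 then 1 else 0) + q * (if i = 2 then 1 else 0) + n * 1 := by
  have hX : ∀ i m : Fin 3, (MvPolynomial.X m : MvPolynomial (Fin 3) ℤ).degreeOf i = if i = m then 1 else 0 :=
    fun i m => MvPolynomial.degreeOf_X i m
  have a0 : ∀ m : Fin 3, ((1 : MvPolynomial (Fin 3) ℤ) - MvPolynomial.X m).degreeOf i ≤ if i = m then 1 else 0 :=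
    fun m => (MvPolynomial.degreeOf_sub_le _ _ _).trans (by rw [MvPolynomial.degreeOf_one, hX]; simp)
  have b0 : (if i = (0 : Fin 3) then 1 else 0) + (if i = (1 : Fin 3) then 1 else 0) +
      (if i = (2 : Fin 3) then 1 else 0) ≤ 1 := by
    fin_cases i <;> simp
  have aD : (1 - (1 - MvPolynomial.X 0 * MvPolynomial.X 1) * MvPolynomial.X 2 :
      MvPolynomial (Fin 3) ℤ).degreeOf i ≤ 1 := by
    refine (MvPolynomial.degreeOf_sub_le _ _ _).trans ?_
    rw [MvPolynomial.degreeOf_one]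
    refine max_le (Nat.zero_le _) ?_
    refine (MvPolynomial.degreeOf_mul_le _ _ _).trans ?_
    have e1 : ((1 : MvPolynomial (Fin 3) ℤ) - MvPolynomial.X 0 * MvPolynomial.X 1).degreeOf i ≤
        (if i = 0 then 1 else 0) + (if i = 1 then 1 else 0) := by
      refine (MvPolynomial.degreeOf_sub_le _ _ _).trans ?_
      rw [MvPolynomial.degreeOf_one]
      refine max_le (Nat.zero_le _) ?_
      refine (MvPolynomial.degreeOf_mul_le _ _ _).trans ?_
      rw [hX, hX]
    rw [hX]
    omega
  have e0 : (MvPolynomial.X 0 ^ h : MvPolynomial (Fin 3) ℤ).degreeOf i ≤ h * (if i = 0 then 1 else 0) :=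
    (MvPolynomial.degreeOf_pow_le i _ h).trans (Nat.mul_le_mul_left h (le_of_eq (hX i 0)))
  have e1 := (MvPolynomial.degreeOf_pow_le i _ l).trans (Nat.mul_le_mul_left l (a0 0))
  have e2 : (MvPolynomial.X 1 ^ k : MvPolynomial (Fin 3) ℤ).degreeOf i ≤ k * (if i = 1 then 1 else 0) :=
    (MvPolynomial.degreeOf_pow_le i _ k).trans (Nat.mul_le_mul_left k (le_of_eq (hX i 1)))
  have e3 := (MvPolynomial.degreeOf_pow_le i _ s).trans (Nat.mul_le_mul_left s (a0 1))
  have e4 : (MvPolynomial.X 2 ^ j : MvPolynomial (Fin 3) ℤ).degreeOf i ≤ j * (if i = 2 then 1 else 0) :=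
    (MvPolynomial.degreeOf_pow_le i _ j).trans (Nat.mul_le_mul_left j (le_of_eq (hX i 2)))
  have e5 := (MvPolynomial.degreeOf_pow_le i _ q).trans (Nat.mul_le_mul_left q (a0 2))
  have e6 := (MvPolynomial.degreeOf_pow_le i _ n).trans (Nat.mul_le_mul_left n aD)
  have m1 := MvPolynomial.degreeOf_mul_le i (MvPolynomial.X 0 ^ h : MvPolynomial (Fin 3) ℤ)
    ((1 - MvPolynomial.X 0) ^ l)
  have m2 := MvPolynomial.degreeOf_mul_le i (MvPolynomial.X 0 ^ h * (1 - MvPolynomial.X 0) ^ l :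
    MvPolynomial (Fin 3) ℤ) (MvPolynomial.X 1 ^ k)
  have m3 := MvPolynomial.degreeOf_mul_le i
    (MvPolynomial.X 0 ^ h * (1 - MvPolynomial.X 0) ^ l * MvPolynomial.X 1 ^ k : MvPolynomial (Fin 3) ℤ)
    ((1 - MvPolynomial.X 1) ^ s)
  have m4 := MvPolynomial.degreeOf_mul_le i
    (MvPolynomial.X 0 ^ h * (1 - MvPolynomial.X 0) ^ l * MvPolynomial.X 1 ^ k * (1 - MvPolynomial.X 1) ^ s :
      MvPolynomial (Fin 3) ℤ) (MvPolynomial.X 2 ^ j)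
  have m5 := MvPolynomial.degreeOf_mul_le i
    (MvPolynomial.X 0 ^ h * (1 - MvPolynomial.X 0) ^ l * MvPolynomial.X 1 ^ k * (1 - MvPolynomial.X 1) ^ s *
      MvPolynomial.X 2 ^ j : MvPolynomial (Fin 3) ℤ) ((1 - MvPolynomial.X 2) ^ q)
  have m6 := MvPolynomial.degreeOf_mul_le i
    (MvPolynomial.X 0 ^ h * (1 - MvPolynomial.X 0) ^ l * MvPolynomial.X 1 ^ k * (1 - MvPolynomial.X 1) ^ s *
      MvPolynomial.X 2 ^ j * (1 - MvPolynomial.X 2) ^ q : MvPolynomial (Fin 3) ℤ)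
    ((1 - (1 - MvPolynomial.X 0 * MvPolynomial.X 1) * MvPolynomial.X 2) ^ n)
  omega

/-- Partial degree in `x`: `≤ h + l + n` (`= r+l−q−1`). [cite: RhinViola2001, §2 p. 274] -/
theorem degreeOf_rvPoly_zero (h l k s j q n : ℕ) :
    (MvPolynomial.X 0 ^ h * (1 - MvPolynomial.X 0) ^ l * MvPolynomial.X 1 ^ k *
        (1 - MvPolynomial.X 1) ^ s * MvPolynomial.X 2 ^ j * (1 - MvPolynomial.X 2) ^ q *
        (1 - (1 - MvPolynomial.X 0 * MvPolynomial.X 1) * MvPolynomial.X 2) ^ n : MvPolynomial (Fin 3) ℤ).degreeOf 0 ≤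
      h + l + n := by
  have := degreeOf_rvPoly_le h l k s j q n 0
  rw [if_pos rfl, if_neg (show ¬((0 : Fin 3) = 1) by decide), if_neg (show ¬((0 : Fin 3) = 2) by decide)] at this
  omega

/-- Partial degree in `y`: `≤ k + s + n` (`= m+s−q−1`). [cite: RhinViola2001, §2 p. 274] -/
theorem degreeOf_rvPoly_one (h l k s j q n : ℕ) :
    (MvPolynomial.X 0 ^ h * (1 - MvPolynomial.X 0) ^ l * MvPolynomial.X 1 ^ k *
        (1 - MvPolynomial.X 1) ^ s * MvPolynomial.X 2 ^ j * (1 - MvPolynomial.X 2) ^ q *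
        (1 - (1 - MvPolynomial.X 0 * MvPolynomial.X 1) * MvPolynomial.X 2) ^ n : MvPolynomial (Fin 3) ℤ).degreeOf 1 ≤
      k + s + n := by
  have := degreeOf_rvPoly_le h l k s j q n 1
  rw [if_neg (show ¬((1 : Fin 3) = 0) by decide), if_pos rfl, if_neg (show ¬((1 : Fin 3) = 2) by decide)] at this
  omega

/-- Partial degree in `z`: `≤ j + q + n` (`= j+r−h−1`). [cite: RhinViola2001, §2 p. 274] -/
theorem degreeOf_rvPoly_two (h l k s j q n : ℕ) :
    (MvPolynomial.X 0 ^ h * (1 - MvPolynomial.X 0) ^ l * MvPolynomial.X 1 ^ k *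
        (1 - MvPolynomial.X 1) ^ s * MvPolynomial.X 2 ^ j * (1 - MvPolynomial.X 2) ^ q *
        (1 - (1 - MvPolynomial.X 0 * MvPolynomial.X 1) * MvPolynomial.X 2) ^ n : MvPolynomial (Fin 3) ℤ).degreeOf 2 ≤
      j + q + n := by
  have := degreeOf_rvPoly_le h l k s j q n 2
  rw [if_neg (show ¬((2 : Fin 3) = 0) by decide), if_neg (show ¬((2 : Fin 3) = 1) by decide), if_pos rfl] at this
  omega

/-- **The polynomial case.** "If `q + h − r < 0`, then `I` is the integral of a polynomial in `x, y, z` with integer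
coefficients and partial degrees `r+l−q−1`, `m+s−q−1`, `j+r−h−1`. Therefore `d_{r+l−q} d_{m+s−q} d_{j+r−h} I ∈ ℤ`."
Here `r+l−q = r'`, `m+s−q = m'`, `j+r−h = j'` of (2.8) (using (2.2)–(2.3)). [cite: RhinViola2001, §2 p. 274] -/
theorem exists_int_of_lt {P : Params} (hP : P.Nonneg) (hB : P.Balanced) (hlt : P.q + P.h - P.r < 0) :
    ∃ A : ℤ, ((d P.aux.r * d P.aux.m * d P.aux.j : ℕ) : ℝ) * I P = A := by
  have hN := hP
  obtain ⟨h0, h1, h2, h3, h4, h5, h6, h7⟩ := hP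
  obtain ⟨hb1, hb2⟩ := hB
  -- natural parameters
  set h := P.h.toNat with hh
  set j := P.j.toNat with hj
  set k := P.k.toNat with hk
  set l := P.l.toNat with hl
  set q := P.q.toNat with hq
  set r := P.r.toNat with hr
  set s := P.s.toNat with hs
  have eh : P.h = h := (Int.toNat_of_nonneg h0).symm
  have ej : P.j = j := (Int.toNat_of_nonneg h1).symm
  have ek : P.k = k := (Int.toNat_of_nonneg h2).symm
  have el : P.l = l := (Int.toNat_of_nonneg h3).symm
  have eq' : P.q = q := (Int.toNat_of_nonneg h5).symm
  have er : P.r = r := (Int.toNat_of_nonneg h6).symm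
  have es : P.s = s := (Int.toNat_of_nonneg h7).symm
  obtain ⟨n, hn⟩ : ∃ n : ℕ, P.r - P.q - P.h - 1 = n := ⟨(P.r - P.q - P.h - 1).toNat, by omega⟩
  -- the three denominators are `d` of the integers `r', m', j'`
  have hA : P.aux.r = ((h + l + n + 1 : ℕ) : ℤ) := by simp only [Params.aux]; push_cast; omega
  have hBm : P.aux.m = ((k + s + n + 1 : ℕ) : ℤ) := by simp only [Params.aux]; push_cast; omega
  have hC : P.aux.j = ((j + q + n + 1 : ℕ) : ℤ) := by simp only [Params.aux]; push_cast; omega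
  rw [hA, hBm, hC, d_natCast, d_natCast, d_natCast]
  -- the integrand is the evaluation of the integer polynomial
  obtain ⟨T, hT⟩ := exists_int_lcm_mul_integral_aeval _ (A := h + l + n + 1) (B := k + s + n + 1)
    (C := j + q + n + 1) (Nat.lt_succ_of_le (degreeOf_rvPoly_zero h l k s j q n))
    (Nat.lt_succ_of_le (degreeOf_rvPoly_one h l k s j q n)) (Nat.lt_succ_of_le (degreeOf_rvPoly_two h l k s j q n))
  have hI : I P = ∫ p in cube, MvPolynomial.aeval p
      (MvPolynomial.X 0 ^ h * (1 - MvPolynomial.X 0) ^ l * MvPolynomial.X 1 ^ k *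
        (1 - MvPolynomial.X 1) ^ s * MvPolynomial.X 2 ^ j * (1 - MvPolynomial.X 2) ^ q *
        (1 - (1 - MvPolynomial.X 0 * MvPolynomial.X 1) * MvPolynomial.X 2) ^ n : MvPolynomial (Fin 3) ℤ) := by
    unfold I
    refine setIntegral_congr_fun (measurableSet_cube 3) fun p hp => ?_
    rw [aeval_rvPoly, integrand_eq_pow hN]
    have hD : (1 - (1 - p 0 * p 1) * p 2) ≠ 0 := (den_pos (hp 0) (hp 1) (hp 2)).ne'
    have hexp : P.q + P.h - P.r + 1 = -(n : ℤ) := by omega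
    rw [hexp, zpow_neg, zpow_natCast, ← hh, ← hj, ← hk, ← hl, ← hq, ← hs, div_inv_eq_mul]
  refine ⟨T, ?_⟩
  rw [hI, ← hT]
  push_cast
  ring

/-! ### The base case (2.11) -/

/-- The integrand of `I(t,0,t,0,t,0,t,0)`: `x^t y^t/(1−(1−xy)z)`. [cite: RhinViola2001, §2 (2.11)] -/
theorem integrand_baseP (t : ℕ) (p : Fin 3 → ℝ) :
    integrand (baseP t) p = p 0 ^ t * p 1 ^ t / (1 - (1 - p 0 * p 1) * p 2) := by
  have hexp : (0 : ℤ) + (t : ℤ) - (t : ℤ) + 1 = 1 := by ring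
  simp only [integrand, baseP, hexp, zpow_natCast, zpow_zero, zpow_one, mul_one]

/-- The `z`-integration of (2.11): for `0 < x, y < 1`,
`∫₀¹ x^t y^t dz/(1−(1−xy)z) = −log(xy)/(1−xy) · x^t y^t`. [cite: RhinViola2001, §2 (2.11) (first equality)] -/
theorem inner_integral_baseP (t : ℕ) {x y : ℝ} (hx : x ∈ Ioo (0 : ℝ) 1) (hy : y ∈ Ioo (0 : ℝ) 1) :
    ∫ z in Ioo (0 : ℝ) 1, x ^ t * y ^ t / (1 - (1 - x * y) * z) =
      -Real.log (x * y) / (1 - x * y) * (x ^ t * y ^ t) := by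
  have hxy0 : 0 < x * y := mul_pos hx.1 hy.1
  have hxy1 : x * y < 1 := by nlinarith [hx.2, hy.2, hx.1, hy.1]
  have ha0 : 0 < 1 - x * y := by linarith
  have ha1 : 1 - x * y < 1 := by linarith
  rw [← integral_Ioc_eq_integral_Ioo, ← intervalIntegral.integral_of_le zero_le_one]
  have : (fun z : ℝ => x ^ t * y ^ t / (1 - (1 - x * y) * z)) =
      fun z => x ^ t * y ^ t * (1 / (1 - (1 - x * y) * z)) := by
    funext z; ring
  rw [this, intervalIntegral.integral_const_mul, integral_one_div_one_sub_mul ha0 ha1]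
  rw [show (1 : ℝ) - (1 - x * y) = x * y by ring]
  ring

/-- **The base case (2.11)**: `I(t,0,t,0,t,0,t,0) = ∫∫∫ x^t y^t dx dy dz/(1−(1−xy)z) = ∫∫ −log(xy)/(1−xy) x^t y^t dx dy
= −2 Σ_{ν=1}^{t} ν⁻³ + 2ζ(3)` "by Lemma 1 of [Beukers]" (the tree's `Beukers.logKernelIntegral_diag_holds`).
[cite: RhinViola2001, §2 (2.11), p. 275] -/
theorem I_baseP (t : ℕ) :
    I (baseP t) = 2 * zetaValue 3 - 2 * ∑ ν ∈ Finset.range t, 1 / ((ν : ℝ) + 1) ^ 3 := by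
  have hF : IntegrableOn (integrand (baseP t)) cube :=
    integrableOn_integrand (by simp [Params.Nonneg, baseP]) (balanced_baseP t)
  have step1 : I (baseP t) = ∫ q in {q : Fin 2 → ℝ | ∀ j, q j ∈ Ioo (0 : ℝ) 1},
      ∫ z in Ioo (0 : ℝ) 1, integrand (baseP t) (Fin.insertNth (2 : Fin 3) z q) := by
    unfold I cube
    exact integral_cube_eq_integral_square_integral 2 _ hF
  have step2 : ∀ q : Fin 2 → ℝ, (∀ j, q j ∈ Ioo (0 : ℝ) 1) →
      ∫ z in Ioo (0 : ℝ) 1, integrand (baseP t) (Fin.insertNth (2 : Fin 3) z q) =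
        -Real.log (q 0 * q 1) / (1 - q 0 * q 1) * (q 0 ^ t * q 1 ^ t) := by
    intro q hq
    simp only [insertNth_two_eq, integrand_baseP, Matrix.cons_val_zero, Matrix.cons_val_one,
      Matrix.cons_val_two, Matrix.tail_cons, Matrix.head_cons]
    exact inner_integral_baseP t (hq 0) (hq 1)
  rw [step1, setIntegral_congr_fun measurableSet_unitSq step2]
  have h := logKernelIntegral_diag_holds t
  rw [logKernelIntegral] at h
  rw [h]
  ring

/-- `lcm(1,…,t)³ · Σ_{ν=1}^{t} ν⁻³ ∈ ℤ`. [cite: RhinViola2001, §2 p. 275 ("(2.9) holds with `d_h³ a ∈ ℤ` and `b = 1`")] -/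
theorem exists_int_lcm_cube_mul_sum (t : ℕ) :
    ∃ A : ℤ, ((Nat.lcmUpto t : ℚ)) ^ 3 * ∑ ν ∈ Finset.range t, 1 / ((ν : ℚ) + 1) ^ 3 = A := by
  refine ⟨((∑ ν ∈ Finset.range t, (Nat.lcmUpto t / (ν + 1)) ^ 3 : ℕ) : ℤ), ?_⟩
  rw [Int.cast_natCast, mul_sum]
  push_cast
  refine sum_congr rfl fun ν hν => ?_
  have hν : ν + 1 ≤ t := by have := Finset.mem_range.1 hν; omega
  have hdvd : ν + 1 ∣ Nat.lcmUpto t := dvd_lcmUpto_of_le (by omega) hν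
  have hL : (Nat.lcmUpto t : ℚ) = ((Nat.lcmUpto t / (ν + 1) : ℕ) : ℚ) * ((ν : ℚ) + 1) := by
    have := Nat.div_mul_cancel hdvd
    exact_mod_cast this.symm
  rw [hL]
  have : ((ν : ℚ) + 1) ≠ 0 := by positivity
  field_simp

/-- The base case is good with denominator `d_t³`: `I(t,0,t,0,t,0,t,0) = a + 2·1·ζ(3)`, `a = −2Σ_{ν≤t} ν⁻³`,
`d_t³ a ∈ ℤ`. [cite: RhinViola2001, §2 p. 275] -/
theorem good_baseP (t : ℕ) : Good (d t * d t * d t) (I (baseP t)) := by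
  obtain ⟨A, hA⟩ := exists_int_lcm_cube_mul_sum t
  refine ⟨-2 * ∑ ν ∈ Finset.range t, 1 / ((ν : ℚ) + 1) ^ 3, 1, ?_, -2 * A, ?_⟩
  · rw [I_baseP]
    push_cast
    ring
  · rw [d_natCast]
    push_cast
    rw [← hA]
    ring

end Theorem21

end Literature.NumberTheory.Irrationality.RhinViola2001

end
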